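import Literature.AlgebraicGeometry.Resolution.RegularLocalOrder
import Mathlib.RingTheory.Valuation.Basic
import Mathlib.RingTheory.Filtration
import Mathlib.Data.ENat.Lattice
import HarnessLib

/-!
# The `𝔪`-adic order of a regular local ring is an `ℕ∞`-valued additive valuation

Topic: `Literature/AlgebraicGeometry/Resolution`. A brick used wherever orders of ideals along REGULAR centres
are added, compared and divided (Hironaka's bookkeeping of orders at the generic points of centres and exceptional
divisors, [Hironaka2017] §3 Eq. (15)–(20) pp.13–15 — an UNREFEREED manuscript adjudicated in repair cell
`pub-hironaka`, nothing of it asserted here; BGMW arXiv:1206.3090 §3.1; Cossart–Piltant 2008 Prop. 4.2): for a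
regular local ring `(R, 𝔪)` the order function `ord(f) = sup {n | f ∈ 𝔪ⁿ} ∈ ℕ∞` is an ADDITIVE VALUATION —
`ord(fg) = ord f + ord g`, `ord(f + g) ≥ min`, `ord 0 = ⊤`, `ord 1 = 0` — and `ord f = ⊤ ⟺ f = 0`.

* `adicOrder f` — the order `sup {n | f ∈ 𝔪ⁿ}` of an element of a local ring, in `ℕ∞`;
* `le_adicOrder_iff` — **`n ≤ ord f ⟺ f ∈ 𝔪ⁿ`**;
* `adicOrder_eq_top_iff` — in a Noetherian local ring `ord f = ⊤ ⟺ f = 0` (Krull's intersection theorem);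
* `adicOrder_mul` — **`ord(fg) = ord f + ord g`** in a regular local ring (from `mul_not_mem_pow_of_not_mem_pow`,
  `RegularLocalOrder.lean`: Zariski–Samuel VIII §1 Thm. 1 via Matsumura Thm. 17.10);
* `ordAddVal : AddValuation R ℕ∞` — the order packaged as a Mathlib additive valuation (`AddValuation.of`), with
  `ordAddVal_apply`, `le_ordAddVal_iff`, `le_ordAddVal_iff_of_ideal` (`(∀ f ∈ J, n ≤ ord f) ⟺ J ⊆ 𝔪ⁿ`).

## Sources

* O. Zariski, P. Samuel, *Commutative Algebra* II (1960), Ch. VIII §1, Thm. 1 and its Corollary (the order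
  function of a regular local ring is a valuation of the ring). [ZariskiSamuel1960]
* H. Matsumura, *Commutative Ring Theory* (1986), Thm. 17.10, Thm. 8.10 (Krull). [Matsumura1987]
* E. Bierstone, D. Grigoriev, P. Milman, J. Włodarczyk, arXiv:1206.3090, §3.1 (`ord_x`). [BierstoneGrigorievMilmanWlodarczyk2011]
-/

namespace Literature.AlgebraicGeometry.Resolution

universe u

open IsLocalRing

variable {R : Type u} [CommRing R]

/-! ## The order of an element of a local ring -/

/-- **The `𝔪`-adic order** `ord(f) = sup {n | f ∈ 𝔪ⁿ} ∈ ℕ∞` of an element of a local ring (`⊤` iff `f ∈ 𝔪ⁿ` for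
all `n`). [cite: ZariskiSamuel1960, Ch. VIII §1] -/
noncomputable def adicOrder [IsLocalRing R] (f : R) : ℕ∞ :=
  ⨆ n : {n : ℕ // f ∈ maximalIdeal R ^ n}, (n.1 : ℕ∞)

/-- `n ≤ ord f ⟺ f ∈ 𝔪ⁿ`. [cite: ZariskiSamuel1960, Ch. VIII §1] -/
theorem le_adicOrder_iff [IsLocalRing R] (f : R) (n : ℕ) :
    (n : ℕ∞) ≤ adicOrder f ↔ f ∈ maximalIdeal R ^ n := by
  constructor
  · intro h
    by_contra hn
    have hlt : ∀ i : {i : ℕ // f ∈ maximalIdeal R ^ i}, i.1 < n := by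
      intro i
      by_contra hi
      exact hn (Ideal.pow_le_pow_right (not_lt.mp hi) i.2)
    have hn0 : n ≠ 0 := by
      rintro rfl
      exact hn (by rw [pow_zero, Ideal.one_eq_top]; exact Submodule.mem_top)
    have : adicOrder f ≤ ((n - 1 : ℕ) : ℕ∞) :=
      iSup_le fun i => by exact_mod_cast Nat.le_sub_one_of_lt (hlt i)
    have h' : n ≤ n - 1 := by exact_mod_cast h.trans this
    omega
  · intro h
    exact le_iSup (fun i : {i : ℕ // f ∈ maximalIdeal R ^ i} => (i.1 : ℕ∞)) ⟨n, h⟩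

/-- `ord f < n + 1 ⟺ f ∉ 𝔪ⁿ⁺¹`. [folklore] -/
theorem adicOrder_lt_iff [IsLocalRing R] (f : R) (n : ℕ) :
    adicOrder f < ((n + 1 : ℕ) : ℕ∞) ↔ f ∉ maximalIdeal R ^ (n + 1) := by
  rw [← le_adicOrder_iff, not_le]

/-- `ord f ≤ n ⟺ f ∉ 𝔪ⁿ⁺¹`. [folklore] -/
theorem adicOrder_le_iff [IsLocalRing R] (f : R) (n : ℕ) :
    adicOrder f ≤ (n : ℕ∞) ↔ f ∉ maximalIdeal R ^ (n + 1) := by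
  rw [← adicOrder_lt_iff, Nat.cast_add, Nat.cast_one]
  exact (ENat.lt_add_one_iff (ENat.coe_ne_top n)).symm

/-- `ord 0 = ⊤`. [folklore] -/
@[simp] theorem adicOrder_zero [IsLocalRing R] : adicOrder (0 : R) = ⊤ :=
  ENat.eq_top_iff_forall_ge.mpr fun n => (le_adicOrder_iff 0 n).mpr (zero_mem _)

/-- `ord 1 = 0` (a local ring is nontrivial: `1 ∉ 𝔪`). [folklore] -/
@[simp] theorem adicOrder_one [IsLocalRing R] : adicOrder (1 : R) = 0 := by
  refine le_antisymm ?_ bot_le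
  rw [← Nat.cast_zero, adicOrder_le_iff, zero_add, pow_one]
  exact fun h => IsLocalRing.maximalIdeal.isMaximal R |>.ne_top (Ideal.eq_top_of_isUnit_mem _ h isUnit_one)

/-- `ord` of a unit is `0`. [folklore] -/
theorem adicOrder_of_isUnit [IsLocalRing R] {u : R} (hu : IsUnit u) : adicOrder u = 0 := by
  refine le_antisymm ?_ bot_le
  rw [← Nat.cast_zero, adicOrder_le_iff, zero_add, pow_one]
  exact fun h => IsLocalRing.maximalIdeal.isMaximal R |>.ne_top (Ideal.eq_top_of_isUnit_mem _ h hu)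

/-- `min (ord f) (ord g) ≤ ord (f + g)`. [folklore] -/
theorem min_adicOrder_le_add [IsLocalRing R] (f g : R) :
    min (adicOrder f) (adicOrder g) ≤ adicOrder (f + g) := by
  refine ENat.forall_natCast_le_iff_le.mp fun n hn => ?_
  rw [le_min_iff, le_adicOrder_iff, le_adicOrder_iff] at hn
  exact (le_adicOrder_iff _ n).mpr (add_mem hn.1 hn.2)

/-- `ord f + ord g ≤ ord (fg)` in any local ring (`𝔪ᵖ 𝔪^q ⊆ 𝔪^{p+q}`). [folklore] -/
theorem adicOrder_add_adicOrder_le_mul [IsLocalRing R] (f g : R) :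
    adicOrder f + adicOrder g ≤ adicOrder (f * g) := by
  -- every `p ≤ ord f`, `q ≤ ord g` give `p + q ≤ ord (fg)`
  have key : ∀ p q : ℕ, (p : ℕ∞) ≤ adicOrder f → (q : ℕ∞) ≤ adicOrder g →
      ((p + q : ℕ) : ℕ∞) ≤ adicOrder (f * g) := by
    intro p q hp hq
    rw [le_adicOrder_iff] at hp hq ⊢
    rw [pow_add]
    exact Ideal.mul_mem_mul hp hq
  induction hf : adicOrder f using ENat.recTopCoe with
  | top =>
    -- `f ∈ 𝔪ⁿ` for all `n`, hence so is `fg`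
    rw [top_add]
    refine (ENat.eq_top_iff_forall_ge.mpr fun n => ?_).ge
    have := key n 0 (by rw [hf]; exact le_top) bot_le
    simpa using this
  | coe p =>
    induction hg : adicOrder g using ENat.recTopCoe with
    | top =>
      rw [add_top]
      refine (ENat.eq_top_iff_forall_ge.mpr fun n => ?_).ge
      have := key 0 n bot_le (by rw [hg]; exact le_top)
      simpa using this
    | coe q =>
      have := key p q (by rw [hf]) (by rw [hg])
      exact_mod_cast this

/-- **Krull**: in a Noetherian local ring `ord f = ⊤ ⟺ f = 0`. [cite: Matsumura1987, Thm. 8.10] -/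
theorem adicOrder_eq_top_iff [IsLocalRing R] [IsNoetherianRing R] (f : R) : adicOrder f = ⊤ ↔ f = 0 := by
  constructor
  · intro h
    have hmem : f ∈ ⨅ n : ℕ, maximalIdeal R ^ n :=
      Ideal.mem_iInf.mpr fun n => (le_adicOrder_iff f n).mp (h ▸ le_top)
    rwa [Ideal.iInf_pow_eq_bot_of_isLocalRing _ (IsLocalRing.maximalIdeal.isMaximal R).ne_top,
      Ideal.mem_bot] at hmem
  · rintro rfl
    exact adicOrder_zero

/-- `ord f ≠ ⊤` for `f ≠ 0` in a Noetherian local ring. [cite: Matsumura1987, Thm. 8.10] -/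
theorem adicOrder_ne_top [IsLocalRing R] [IsNoetherianRing R] {f : R} (hf : f ≠ 0) : adicOrder f ≠ ⊤ :=
  fun h => hf ((adicOrder_eq_top_iff f).mp h)

/-! ## Regular local rings: the order is additive -/

section Regular

variable [IsRegularLocalRing R]

/-- **`ord(fg) = ord f + ord g` in a regular local ring** (the order function is a valuation: Zariski–Samuel
VIII §1 Thm. 1, from `gr_𝔪(R)` a polynomial ring, Matsumura 17.10; here from `mul_not_mem_pow_of_not_mem_pow`).
[cite: ZariskiSamuel1960, Ch. VIII §1 Thm. 1] -/
theorem adicOrder_mul (f g : R) : adicOrder (f * g) = adicOrder f + adicOrder g := by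
  refine le_antisymm ?_ (adicOrder_add_adicOrder_le_mul f g)
  by_cases hf : f = 0
  · subst hf; simp
  by_cases hg : g = 0
  · subst hg; simp
  -- finite orders `p`, `q`
  obtain ⟨p, hp⟩ := ENat.ne_top_iff_exists.mp (adicOrder_ne_top hf)
  obtain ⟨q, hq⟩ := ENat.ne_top_iff_exists.mp (adicOrder_ne_top hg)
  rw [← hp, ← hq]
  have hfp : f ∉ maximalIdeal R ^ (p + 1) := (adicOrder_le_iff f p).mp hp.symm.le
  have hgq : g ∉ maximalIdeal R ^ (q + 1) := (adicOrder_le_iff g q).mp hq.symm.le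
  have := mul_not_mem_pow_of_not_mem_pow hfp hgq
  have h' : adicOrder (f * g) ≤ ((p + q : ℕ) : ℕ∞) := (adicOrder_le_iff _ _).mpr this
  exact_mod_cast h'

/-- `ord(fⁿ) = n · ord f` in a regular local ring. [cite: ZariskiSamuel1960, Ch. VIII §1 Thm. 1] -/
theorem adicOrder_pow (f : R) (n : ℕ) : adicOrder (f ^ n) = n * adicOrder f := by
  induction n with
  | zero => simp
  | succ n ih => rw [pow_succ, adicOrder_mul, ih, Nat.cast_succ, add_mul, one_mul]

variable (R) in
/-- **The order valuation of a regular local ring**: `f ↦ ord_𝔪(f)` as an `ℕ∞`-valued additive valuation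
(Mathlib `AddValuation`). [cite: ZariskiSamuel1960, Ch. VIII §1 Thm. 1 and Corollary] -/
noncomputable def ordAddVal : AddValuation R ℕ∞ :=
  AddValuation.of adicOrder adicOrder_zero adicOrder_one min_adicOrder_le_add adicOrder_mul

/-- `ordAddVal f = ord f`. [folklore] -/
@[simp] theorem ordAddVal_apply (f : R) : ordAddVal R f = adicOrder f := rfl

/-- `n ≤ ordAddVal f ⟺ f ∈ 𝔪ⁿ`. [cite: ZariskiSamuel1960, Ch. VIII §1] -/
theorem le_ordAddVal_iff (f : R) (n : ℕ) : (n : ℕ∞) ≤ ordAddVal R f ↔ f ∈ maximalIdeal R ^ n :=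
  le_adicOrder_iff f n

/-- Ideal form: `(∀ f ∈ J, n ≤ ord f) ⟺ J ⊆ 𝔪ⁿ` — "the order of `J` along the regular centre is `≥ n`".
[cite: BierstoneGrigorievMilmanWlodarczyk2011, §3.1] -/
theorem forall_le_ordAddVal_iff (J : Ideal R) (n : ℕ) :
    (∀ f ∈ J, (n : ℕ∞) ≤ ordAddVal R f) ↔ J ≤ maximalIdeal R ^ n :=
  forall₂_congr fun f _ => le_ordAddVal_iff f n

/-- `ordAddVal f = ⊤ ⟺ f = 0`. [cite: Matsumura1987, Thm. 8.10] -/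
theorem ordAddVal_eq_top_iff (f : R) : ordAddVal R f = ⊤ ↔ f = 0 := adicOrder_eq_top_iff f

end Regular

end Literature.AlgebraicGeometry.Resolution
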